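import Mathlib
import Literature.NumberTheory.Transcendental.GammaIsoCross
import Literature.NumberTheory.Transcendental.ZilberGenericClosedness
import Literature.NumberTheory.Transcendental.PseudoExpVariants
import Literature.NumberTheory.Transcendental.PseudoExpAmbient
import Literature.NumberTheory.Transcendental.GammaFieldsEcl
import Literature.ModelTheory.Quasiminimal.ContinuumStrong
import Summits.Schanuel.Schanuel.Theorems.RigidCoreAclSubsetLogFreeCoreDoubleBaseAux4

/-!
# The double of a free extension inside `ℂ`: the first copy is strong in the double; the
conjuncts of the stub (auxiliary file 5 for the stub `stub_doubleBase` of line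
`eac-extends-core-automorphisms`, crux stmt-Schanuel-0968)

Continuing auxiliary files 2–4 (same local notations; no new definitions). With a subfield
`K ≤ ℂ` carrying the double (`hDK`, `hθK`), the two copies `j₁ = incl`, `j₂ = φ : 𝔽 → K`
(`hj₁`, `hj₂`), `θ` on `K` (`hθK`) and `t = τ` (`ht`):

* the conjuncts of the stub about the two copies: `τ ↦ t` (`j_tau`), agreement on the generators
  of the Γ-field of `𝕏` (`j_agree`), `θ ∘ jᵢ = jᵢ ∘ exp` on `𝕎` (`theta_j`), general position
  `Σ qⱼ (j₂ eⱼ − j₁ eⱼ) ∉ ℚt + ℚ j₁(c)` for `q ≠ 0` (`genPos`);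
* **internal strongness of the first copy**: for every `ℚ`-subspace `V` with
  `𝕎 ≤ V ≤ D_ℂ = 𝕎 + φ(𝕎)`, `ldim(V/𝕎) ≤ relRank(𝕎 ∪ exp 𝕎)(V ∪ θ V)` in the algebraic matroid
  (`strongC`), and its transport to `K` (`strongK`, the sixth conjunct). Proof: `V = 𝕎 ⊕_𝕏 V'`
  with `𝕏 ≤ V' ≤ φ(𝕎)`, `V' = φ(U)` for `𝕏 ≤ U ≤ 𝕎`; `ldim(V/𝕎) = ldim(U/𝕏) ≤ td(U/𝕏)` because
  `𝕏 ◁ ℂ`; `td(U/𝕏)` is the relative rank of `gens U` over `gens 𝕏`, invariant under `φ`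
  (`MatroidComap.relRank_image_ringHom`), equal to the rank of `φ(gens U)` over `𝔽` by
  genericity, which is at most its rank over `gens 𝕎 ⊆ 𝔽`; finally `φ(gens U) ⊆ V ∪ θ(V)`.
-/

noncomputable section

set_option linter.dupNamespace false

open Set
open scoped Matroid
open Literature.ModelTheory.ExponentialFields Literature.ModelTheory.ExponentialFields.ExponentialRing
open Literature.NumberTheory.Transcendental Literature.NumberTheory.Transcendental.GammaField

namespace Summit.Schanuel.Schanuel.Theorems.RigidCore

namespace DoubleBase

variable {τ : ℂ} {N k : ℕ} {c : Fin N → ℂ} {e : Fin k → ℂ}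

set_option quotPrecheck false in
/-- `𝕏 = ℚτ + ℚc` (local notation only). -/
local notation "𝕏" =>
  (Submodule.span ℚ ({τ} : Set ℂ) ⊔ Submodule.span ℚ (Set.range c) : Submodule ℚ ℂ)

set_option quotPrecheck false in
/-- `𝕎 = ℚτ + ℚ(c, e) = 𝕏 + ℚe` (local notation only). -/
local notation "𝕎" => (Submodule.span ℚ ({τ} : Set ℂ) ⊔
  Submodule.span ℚ (Set.range (Fin.append c e)) : Submodule ℚ ℂ)

set_option quotPrecheck false in
/-- `𝔽 = ℚ(𝕎 ∪ exp 𝕎)`, the Γ-field of `𝕎` (local notation only). -/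
local notation "𝔽" => (fieldOf (F := ℂ)
  (Submodule.span ℚ ({τ} : Set ℂ) ⊔ Submodule.span ℚ (Set.range (Fin.append c e))))

set_option quotPrecheck false in
/-- Freeness of `e` over `𝕏` (local notation only). -/
local notation "FreeH" => (∀ m : Fin k → ℤ, m ≠ 0 →
  (∑ j, (m j : ℚ) • e j) ∉ acl (gens 𝕏) ∧ Complex.exp (∑ j, (m j : ℚ) • e j) ∉ acl (gens 𝕏))

set_option quotPrecheck false in
/-- `φ` is the identity on `ℚ(gens 𝕏)` (local notation only). -/
local notation "FixH[" φ "]" => (∀ (x : ℂ) (hx : x ∈ 𝔽), x ∈ fieldOf 𝕏 → φ ⟨x, hx⟩ = x)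

set_option quotPrecheck false in
/-- `φ(𝔽)` is algebraically disjoint from `𝔽` over `ℚ(gens 𝕏)` (local notation only). -/
local notation "RelH[" φ "]" => (∀ S : Set 𝔽,
  (algMatroid ℂ).relRank ((𝔽 : IntermediateField ℚ ℂ) : Set ℂ) (φ '' S) =
    (algMatroid ℂ).relRank (fieldOf 𝕏 : Set ℂ) (φ '' S))

set_option quotPrecheck false in
/-- `e' = φ ∘ e` (local notation only). -/
local notation "EpH[" φ "," e' "]" => (∀ (j : Fin k) (h : e j ∈ 𝔽), φ ⟨e j, h⟩ = e' j)

set_option quotPrecheck false in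
/-- The characterising property of the partial exponential `θ` (local notation only). -/
local notation "ThH[" φ "," e' "," θ "]" => (∀ w ∈ 𝕎, ∀ (q : Fin k → ℚ)
  (h : Complex.exp (∑ j, q j • e j) ∈ 𝔽),
  θ (w + ∑ j, q j • e' j) = Complex.exp w * φ ⟨Complex.exp (∑ j, q j • e j), h⟩)

set_option quotPrecheck false in
/-- `𝔻[e'] = 𝕎 + ℚe'`, the domain `D_ℂ` inside `ℂ` (local notation only). -/
local notation "𝔻[" e' "]" => ((Submodule.span ℚ ({τ} : Set ℂ) ⊔
  Submodule.span ℚ (Set.range (Fin.append c e))) ⊔ Submodule.span ℚ (Set.range e') : Submodule ℚ ℂ)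

set_option quotPrecheck false in
/-- `𝔻K[j₁, j₂] = span (j₁ 𝕎 ∪ j₂ 𝕎)`, the domain `D ≤ K`, literally as in the stub (local
notation only). -/
local notation "𝔻K[" j₁ "," j₂ "]" => (Submodule.span ℚ
  ((fun x : 𝔽 => j₁ x) '' {x : 𝔽 | (x : ℂ) ∈ Submodule.span ℚ ({τ} : Set ℂ) ⊔
      Submodule.span ℚ (Set.range (Fin.append c e))} ∪
    (fun x : 𝔽 => j₂ x) '' {x : 𝔽 | (x : ℂ) ∈ Submodule.span ℚ ({τ} : Set ℂ) ⊔
      Submodule.span ℚ (Set.range (Fin.append c e))}))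

/-! ### General position of the two copies -/

/-- **General position of the two copies**: `Σ qⱼ (j₂ eⱼ − j₁ eⱼ) ∉ ℚt + ℚ j₁(c)` for `q ≠ 0`
(otherwise `Σ qⱼ e'ⱼ ∈ 𝕎`, contradicting `ePr_linIndep`). -/
theorem genPos {φ : 𝔽 →+* ℂ} {e' : Fin k → ℂ} (he' : EpH[φ, e']) (hlin : LinIndepOver 𝕏 e)
    (hfree : FreeH) (hfix : FixH[φ]) (hrel : RelH[φ]) {K : Subfield ℂ} {j₁ j₂ : 𝔽 →+* K}
    (hj₁ : ∀ x, (j₁ x : ℂ) = x) (hj₂ : ∀ x, (j₂ x : ℂ) = φ x) {v : K →ₗ[ℚ] ℂ}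
    (hv : ∀ x, v x = x) {t : K} (ht : (t : ℂ) = τ) (hcF : ∀ i, c i ∈ 𝔽) (heF : ∀ j, e j ∈ 𝔽)
    (q : Fin k → ℚ) (hq : q ≠ 0) :
    (∑ j, q j • (j₂ ⟨e j, heF j⟩ - j₁ ⟨e j, heF j⟩)) ∉
      Submodule.span ℚ ({t} : Set K) ⊔ Submodule.span ℚ (range fun i => j₁ ⟨c i, hcF i⟩) := by
  intro hmem
  apply hq
  have h1 := Submodule.mem_map_of_mem (f := v) hmem
  rw [Submodule.map_sup, Submodule.map_span, Submodule.map_span, image_singleton,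
    ← range_comp] at h1
  have ht' : v t = τ := (hv t).trans ht
  have hc' : (v ∘ fun i => j₁ ⟨c i, hcF i⟩) = c := by
    funext i
    change v (j₁ _) = c i
    rw [hv, hj₁]
  rw [ht', hc'] at h1
  have h2 : (∑ j, q j • (e' j - e j)) ∈ 𝕏 := by
    have hval : v (∑ j, q j • (j₂ ⟨e j, heF j⟩ - j₁ ⟨e j, heF j⟩)) = ∑ j, q j • (e' j - e j) := by
      simp only [map_sum, map_smul, map_sub]
      simp only [hv, hj₁, hj₂, he']
    rw [← hval]
    exact h1
  refine ePr_linIndep he' hlin hfree hfix hrel q ?_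
  have : (∑ j, q j • e' j) = (∑ j, q j • (e' j - e j)) + ∑ j, q j • e j := by
    rw [← Finset.sum_add_distrib]
    refine Finset.sum_congr rfl fun j _ => ?_
    rw [smul_sub, sub_add_cancel]
  rw [this]
  exact Submodule.add_mem _ (Xsp_le_Wsp e h2) (sum_smul_e_mem_Wsp τ c e q)

/-! ### Internal strongness of the first copy -/

/-- `φ|_𝕎` as a `ℚ`-linear map `ψ : 𝕎 → ℂ` (existence). -/
theorem exists_psi (φ : 𝔽 →+* ℂ) :
    ∃ ψ : 𝕎 →ₗ[ℚ] ℂ, ∀ w : 𝕎, ψ w = φ ⟨w, mem_Fd_of_mem w.2⟩ :=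
  ⟨{ toFun := fun w => φ ⟨w, mem_Fd_of_mem w.2⟩
     map_add' := fun a b => phi_add φ (mem_Fd_of_mem a.2) (mem_Fd_of_mem b.2)
     map_smul' := fun q a => phi_smul φ q (mem_Fd_of_mem a.2) _ }, fun _ => rfl⟩

/-- **The first copy `𝕎` is strong in the double** (`ℂ`-level): for `𝕎 ≤ V ≤ D_ℂ`,
`ldim(V/𝕎) ≤ relRank(gens 𝕎)(V ∪ θ V)` in the algebraic matroid of `ℂ/ℚ`. -/
theorem strongC {φ : 𝔽 →+* ℂ} {e' : Fin k → ℂ} {θ : ℂ → ℂ} (hθ : ThH[φ, e', θ])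
    (he' : EpH[φ, e']) (hlin : LinIndepOver 𝕏 e) (hfree : FreeH) (hfix : FixH[φ])
    (hrel : RelH[φ]) (hX : IsStrong 𝕏) {Vc : Submodule ℚ ℂ} (hWV : 𝕎 ≤ Vc) (hVD : Vc ≤ 𝔻[e']) :
    ((ldim 𝕎 Vc : ℕ) : ℕ∞) ≤
      (algMatroid ℂ).relRank (gens 𝕎) ((Vc : Set ℂ) ∪ θ '' (Vc : Set ℂ)) := by
  classical
  obtain ⟨ψ, hψ⟩ := exists_psi φ
  have hψinj : Function.Injective ψ := by
    intro a b hab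
    rw [hψ, hψ] at hab
    have h2 : (a : ℂ) = b := congrArg (fun x : 𝔽 => (x : ℂ)) (φ.injective hab)
    exact Subtype.ext h2
  have hrange : LinearMap.range ψ = 𝕏 ⊔ Submodule.span ℚ (range e') := by
    apply le_antisymm
    · rintro _ ⟨w, rfl⟩
      obtain ⟨y, hy, q, hyq⟩ := mem_Wsp_iff.1 w.2
      rw [hψ, show (⟨(w : ℂ), mem_Fd_of_mem w.2⟩ : 𝔽) =
        ⟨y + ∑ j, q j • e j, hyq ▸ mem_Fd_of_mem w.2⟩ from Subtype.ext hyq,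
        phi_of_mem_W he' hfix hy q]
      exact Submodule.add_mem _ (Submodule.mem_sup_left hy)
        (Submodule.mem_sup_right (Submodule.sum_mem _ fun j _ =>
          Submodule.smul_mem _ _ (Submodule.subset_span ⟨j, rfl⟩)))
    · refine sup_le ?_ ?_
      · intro y hy
        exact ⟨⟨y, Xsp_le_Wsp e hy⟩, (hψ _).trans (hfix y _ (mem_F₀_of_mem hy))⟩
      · rw [Submodule.span_le]
        rintro _ ⟨j, rfl⟩
        exact ⟨⟨e j, e_mem_Wsp τ c e j⟩, (hψ _).trans (he' j _)⟩
  set W'sp : Submodule ℚ ℂ := 𝕏 ⊔ Submodule.span ℚ (range e') with hW'sp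
  set V' : Submodule ℚ ℂ := Vc ⊓ W'sp with hV'
  -- `V = 𝕎 + V'` with `V' ∩ 𝕎 = 𝕏`
  have hVc : Vc = 𝕎 ⊔ V' := by
    apply le_antisymm
    · intro z hz
      obtain ⟨w, hw, s, hs, rfl⟩ := Submodule.mem_sup.1 (hVD hz)
      have hsV : s ∈ Vc := by
        have : s = (w + s) - w := by ring
        rw [this]
        exact Vc.sub_mem hz (hWV hw)
      exact Submodule.mem_sup.2 ⟨w, hw, s, ⟨hsV, Submodule.mem_sup_right hs⟩, rfl⟩
    · exact sup_le hWV inf_le_left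
  have hV'W : V' ⊓ 𝕎 = 𝕏 := by
    apply le_antisymm
    · rintro z ⟨⟨_, hzW'⟩, hzW⟩
      exact mem_X_of_mem_W_of_mem_W' he' hlin hfree hfix hrel hzW hzW'
    · intro x hx
      exact ⟨⟨hWV (Xsp_le_Wsp e hx), Submodule.mem_sup_left hx⟩, Xsp_le_Wsp e hx⟩
  have hld1 : ldim 𝕎 Vc = ldim 𝕏 V' := by
    rw [hVc, ldim_sup_left, ldim_eq_ldim_inf, hV'W]
  -- pull `V'` back along `ψ = φ|_𝕎`
  set U_W : Submodule ℚ 𝕎 := V'.comap ψ with hU_W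
  set X_W : Submodule ℚ 𝕎 := (𝕏).comap (Submodule.subtype 𝕎) with hX_W
  have hmapU : U_W.map ψ = V' := by
    rw [hU_W, Submodule.map_comap_eq, hrange]
    exact inf_of_le_right inf_le_right
  have hmapX : X_W.map ψ = 𝕏 := by
    ext z
    constructor
    · rintro ⟨w, hw, rfl⟩
      have hw' : (w : ℂ) ∈ 𝕏 := hw
      rw [hψ, hfix _ _ (mem_F₀_of_mem hw')]
      exact hw'
    · intro hz
      exact ⟨⟨z, Xsp_le_Wsp e hz⟩, hz, (hψ _).trans (hfix _ _ (mem_F₀_of_mem hz))⟩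
  set U : Submodule ℚ ℂ := U_W.map (Submodule.subtype 𝕎) with hU
  have hmapX' : X_W.map (Submodule.subtype 𝕎) = 𝕏 := by
    rw [hX_W, Submodule.map_comap_subtype]
    exact inf_of_le_right (Xsp_le_Wsp e)
  have hld2 : ldim 𝕏 V' = ldim 𝕏 U := by
    have h1 : ldim 𝕏 V' = ldim X_W U_W := by
      rw [← hmapU, ← hmapX, ldim_map_of_injective _ hψinj]
    have h2 : ldim 𝕏 U = ldim X_W U_W := by
      rw [hU, ← hmapX', ldim_map_of_injective _ (Submodule.injective_subtype _)]
    rw [h1, h2]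
  -- `𝕏 ≤ U ≤ 𝕎`, so `ldim(U/𝕏) ≤ td(U/𝕏)` by strongness of `𝕏`
  have hXU : 𝕏 ≤ U := by
    intro x hx
    refine ⟨⟨x, Xsp_le_Wsp e hx⟩, ?_, rfl⟩
    change ψ ⟨x, Xsp_le_Wsp e hx⟩ ∈ V'
    rw [hψ, hfix _ _ (mem_F₀_of_mem hx)]
    exact ⟨hWV (Xsp_le_Wsp e hx), Submodule.mem_sup_left hx⟩
  have hUW : U ≤ 𝕎 := Submodule.map_subtype_le _ _
  have hfg : IsFG 𝕏 U := (isFG_Xsp_Wsp τ c e).mono hUW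
  have hpre : 0 ≤ predim 𝕏 U := hX hXU hfg
  rw [predim_def] at hpre
  have htd : ((ldim 𝕏 U : ℕ) : ℕ∞) ≤ td 𝕏 U := by
    rw [← ENat.coe_toNat (td_ne_top hfg)]
    exact_mod_cast (by linarith : (ldim 𝕏 U : ℤ) ≤ (td 𝕏 U).toNat)
  -- transport `td(U/𝕏)` through `φ`, then use genericity
  set A : Set 𝔽 := ((↑) : 𝔽 → ℂ) ⁻¹' gens 𝕏 with hA
  set B : Set 𝔽 := ((↑) : 𝔽 → ℂ) ⁻¹' gens U with hB
  have hgXF : gens 𝕏 ⊆ ((𝔽 : IntermediateField ℚ ℂ) : Set ℂ) :=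
    (gens_mono (Xsp_le_Wsp e)).trans (gens_Wsp_subset_Fd τ c e)
  have hgUF : gens U ⊆ ((𝔽 : IntermediateField ℚ ℂ) : Set ℂ) :=
    (gens_mono hUW).trans (gens_Wsp_subset_Fd τ c e)
  have hvalA : ((↑) : 𝔽 → ℂ) '' A = gens 𝕏 := by
    ext z; constructor
    · rintro ⟨y, hy, rfl⟩; exact hy
    · intro hz; exact ⟨⟨z, hgXF hz⟩, hz, rfl⟩
  have hvalB : ((↑) : 𝔽 → ℂ) '' B = gens U := by
    ext z; constructor
    · rintro ⟨y, hy, rfl⟩; exact hy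
    · intro hz; exact ⟨⟨z, hgUF hz⟩, hz, rfl⟩
  have hφA : φ '' A = gens 𝕏 := by
    rw [← hvalA]
    refine image_congr fun y hy => ?_
    exact hfix _ _ (gens_subset_fieldOf _ hy)
  have htd' : td 𝕏 U = (algMatroid ℂ).relRank (gens 𝕏) (φ '' B) := by
    rw [td_def, ← hvalB]
    conv_lhs => rw [← hvalA]
    conv_rhs => rw [← hφA]
    change (AlgebraicIndependent.matroid ℚ ℂ).relRank ((algebraMap 𝔽 ℂ) '' A)
        ((algebraMap 𝔽 ℂ) '' B) = _
    rw [MatroidComap.relRank_image_ringHom _ (algebraMap 𝔽 ℂ).injective,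
      ← MatroidComap.relRank_image_ringHom φ φ.injective]
  have hgen : (algMatroid ℂ).relRank (gens 𝕏) (φ '' B) =
      (algMatroid ℂ).relRank ((𝔽 : IntermediateField ℚ ℂ) : Set ℂ) (φ '' B) := by
    rw [hrel B]
    exact (algMatroid ℂ).relRank_congr_closure_left _ (acl_fieldOf 𝕏).symm
  -- `φ(gens U) ⊆ V ∪ θ(V)`
  have hBV : φ '' B ⊆ (Vc : Set ℂ) ∪ θ '' (Vc : Set ℂ) := by
    rintro _ ⟨y, hy, rfl⟩
    rcases hy with hyU | ⟨u, huU, hu⟩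
    · obtain ⟨w, hw, hwy⟩ := hyU
      have hψw : ψ w ∈ Vc := hw.1
      refine Or.inl ?_
      rw [show y = ⟨(w : ℂ), mem_Fd_of_mem w.2⟩ from Subtype.ext hwy.symm, ← hψ]
      exact hψw
    · obtain ⟨w, hw, rfl⟩ := huU
      have hψw : ψ w ∈ Vc := hw.1
      refine Or.inr ⟨ψ w, hψw, ?_⟩
      rw [hψ, theta_phi hθ he' hfix w.2,
        show y = ⟨Complex.exp (w : ℂ), exp_mem_Fd w.2⟩ from Subtype.ext hu.symm]
  calc ((ldim 𝕎 Vc : ℕ) : ℕ∞)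
      = ((ldim 𝕏 U : ℕ) : ℕ∞) := by rw [hld1, hld2]
    _ ≤ td 𝕏 U := htd
    _ = (algMatroid ℂ).relRank ((𝔽 : IntermediateField ℚ ℂ) : Set ℂ) (φ '' B) := by rw [htd', hgen]
    _ ≤ (algMatroid ℂ).relRank (gens 𝕎) (φ '' B) :=
        (algMatroid ℂ).relRank_anti_left _ (gens_Wsp_subset_Fd τ c e)
    _ ≤ (algMatroid ℂ).relRank (gens 𝕎) ((Vc : Set ℂ) ∪ θ '' (Vc : Set ℂ)) :=
        (algMatroid ℂ).relRank_mono_right _ hBV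

/-- **The first copy is strong in `(K, D, θ)`** — the sixth conjunct of the stub, transported
from `strongC` along the inclusion `K ≤ ℂ` (`ldim` and relative rank are invariant under
injective linear maps / field embeddings). -/
theorem strongK {φ : 𝔽 →+* ℂ} {e' : Fin k → ℂ} {θ : ℂ → ℂ} (hθ : ThH[φ, e', θ])
    (he' : EpH[φ, e']) (hlin : LinIndepOver 𝕏 e) (hfree : FreeH) (hfix : FixH[φ])
    (hrel : RelH[φ]) (hX : IsStrong 𝕏) {K : Subfield ℂ} {j₁ j₂ : 𝔽 →+* K}
    (hj₁ : ∀ x, (j₁ x : ℂ) = x) (hj₂ : ∀ x, (j₂ x : ℂ) = φ x) {v : K →ₗ[ℚ] ℂ} (hv : ∀ x, v x = x)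
    {θK : K → K} (hθK : ∀ z : K, (z : ℂ) ∈ 𝔻[e'] → (θK z : ℂ) = θ z)
    (V : Submodule ℚ K)
    (hV1 : Submodule.span ℚ ((fun x : 𝔽 => j₁ x) '' {x : 𝔽 | (x : ℂ) ∈ 𝕎}) ≤ V)
    (hV2 : V ≤ 𝔻K[j₁, j₂]) :
    ((ldim (Submodule.span ℚ ((fun x : 𝔽 => j₁ x) '' {x : 𝔽 | (x : ℂ) ∈ 𝕎})) V : ℕ) : ℕ∞) ≤
      (algMatroid K).relRank
        (↑(Submodule.span ℚ ((fun x : 𝔽 => j₁ x) '' {x : 𝔽 | (x : ℂ) ∈ 𝕎})) ∪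
          θK '' ↑(Submodule.span ℚ ((fun x : 𝔽 => j₁ x) '' {x : 𝔽 | (x : ℂ) ∈ 𝕎})))
        (↑V ∪ θK '' ↑V) := by
  classical
  set S₁ : Submodule ℚ K := Submodule.span ℚ ((fun x : 𝔽 => j₁ x) '' {x : 𝔽 | (x : ℂ) ∈ 𝕎})
    with hS₁
  have hmemD := mem_DK_iff he' hfix hj₁ hj₂ hv
  have hvinj : Function.Injective v := fun x y hxy => Subtype.ext (by rw [← hv x, ← hv y]; exact hxy)
  -- images in `ℂ`
  have hS₁map : S₁.map v = 𝕎 := by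
    rw [hS₁, Submodule.map_span, ← image_comp]
    have h1 : (v ∘ fun x : 𝔽 => j₁ x) '' {x : 𝔽 | (x : ℂ) ∈ 𝕎} = ((𝕎 : Submodule ℚ ℂ) : Set ℂ) := by
      ext z
      constructor
      · rintro ⟨x, hx, rfl⟩
        change v (j₁ x) ∈ 𝕎
        rw [hv, hj₁]; exact hx
      · intro hz
        refine ⟨⟨z, mem_Fd_of_mem hz⟩, hz, ?_⟩
        change v (j₁ _) = z
        rw [hv, hj₁]
    rw [h1, Submodule.span_eq]
  set Vc : Submodule ℚ ℂ := V.map v with hVc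
  have hWV : 𝕎 ≤ Vc := hS₁map ▸ Submodule.map_mono hV1
  have hVD : Vc ≤ 𝔻[e'] := map_DK_eq he' hfix hj₁ hj₂ hv ▸ Submodule.map_mono hV2
  have hSD : ∀ z ∈ S₁, (z : ℂ) ∈ 𝔻[e'] := fun z hz => (hmemD z).1 (hV2 (hV1 hz))
  have hVD' : ∀ z ∈ V, (z : ℂ) ∈ 𝔻[e'] := fun z hz => (hmemD z).1 (hV2 hz)
  -- transport of the images of `θ`
  have himg : ∀ T : Submodule ℚ K, (∀ z ∈ T, (z : ℂ) ∈ 𝔻[e']) →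
      (K.subtype : K → ℂ) '' (↑T ∪ θK '' ↑T) =
        ((T.map v : Submodule ℚ ℂ) : Set ℂ) ∪ θ '' ↑(T.map v) := by
    intro T hT
    rw [image_union, Submodule.map_coe, image_image, image_image]
    congr 1
    · exact image_congr fun z _ => (hv z).symm
    · refine image_congr fun z hz => ?_
      change ((θK z : K) : ℂ) = θ (v z)
      rw [hv]
      exact hθK z (hT z hz)
  have hld : ldim S₁ V = ldim 𝕎 Vc := by
    rw [← hS₁map, hVc, ldim_map_of_injective v hvinj]
  have hrk : (algMatroid K).relRank (↑S₁ ∪ θK '' ↑S₁) (↑V ∪ θK '' ↑V) =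
      (algMatroid ℂ).relRank (gens 𝕎) ((Vc : Set ℂ) ∪ θ '' (Vc : Set ℂ)) := by
    rw [← MatroidComap.relRank_image_ringHom K.subtype Subtype.val_injective,
      himg S₁ hSD, himg V hVD', hS₁map]
    congr 1
    change ((𝕎 : Submodule ℚ ℂ) : Set ℂ) ∪ θ '' ((𝕎 : Submodule ℚ ℂ) : Set ℂ) =
      ((𝕎 : Submodule ℚ ℂ) : Set ℂ) ∪ exp '' ((𝕎 : Submodule ℚ ℂ) : Set ℂ)
    congr 1
    exact image_congr fun w hw => theta_of_mem_W hθ hw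
  rw [hld, hrk]
  exact strongC hθ he' hlin hfree hfix hrel hX hWV hVD

end DoubleBase


/-- **Registered sub-goal of `stub_doubleBase` (auxiliary file 5): the two copies are in general
position** — `DoubleBase.genPos` restated without local notations. -/
theorem doubleBase_genPos (τ : ℂ) {N k : ℕ} (c : Fin N → ℂ) (e : Fin k → ℂ)
    (φ : fieldOf (Submodule.span ℚ ({τ} : Set ℂ) ⊔ Submodule.span ℚ (range (Fin.append c e))) →+* ℂ)
    (e' : Fin k → ℂ)
    (he' : ∀ (j : Fin k) (h : e j ∈ fieldOf (Submodule.span ℚ ({τ} : Set ℂ) ⊔ Submodule.span ℚ (range (Fin.append c e)))),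
      φ ⟨e j, h⟩ = e' j)
    (hlin : LinIndepOver (Submodule.span ℚ ({τ} : Set ℂ) ⊔ Submodule.span ℚ (range c)) e)
    (hfree : ∀ m : Fin k → ℤ, m ≠ 0 →
      (∑ j, (m j : ℚ) • e j) ∉ acl (gens (Submodule.span ℚ ({τ} : Set ℂ) ⊔ Submodule.span ℚ (range c))) ∧
      Complex.exp (∑ j, (m j : ℚ) • e j) ∉ acl (gens (Submodule.span ℚ ({τ} : Set ℂ) ⊔ Submodule.span ℚ (range c))))
    (hfix : ∀ (x : ℂ) (hx : x ∈ fieldOf (Submodule.span ℚ ({τ} : Set ℂ) ⊔ Submodule.span ℚ (range (Fin.append c e)))),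
      x ∈ fieldOf (Submodule.span ℚ ({τ} : Set ℂ) ⊔ Submodule.span ℚ (range c)) → φ ⟨x, hx⟩ = x)
    (hrel : ∀ S : Set (fieldOf (Submodule.span ℚ ({τ} : Set ℂ) ⊔ Submodule.span ℚ (range (Fin.append c e)))),
      (algMatroid ℂ).relRank ((fieldOf (Submodule.span ℚ ({τ} : Set ℂ) ⊔ Submodule.span ℚ (range (Fin.append c e))) :
        IntermediateField ℚ ℂ) : Set ℂ) (φ '' S) =
      (algMatroid ℂ).relRank (fieldOf (Submodule.span ℚ ({τ} : Set ℂ) ⊔ Submodule.span ℚ (range c)) : Set ℂ) (φ '' S))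
    (K : Subfield ℂ) (j₁ j₂ : fieldOf (Submodule.span ℚ ({τ} : Set ℂ) ⊔ Submodule.span ℚ (range (Fin.append c e))) →+* K)
    (hj₁ : ∀ x, (j₁ x : ℂ) = x) (hj₂ : ∀ x, (j₂ x : ℂ) = φ x) (v : K →ₗ[ℚ] ℂ) (hv : ∀ x, v x = x)
    (t : K) (ht : (t : ℂ) = τ)
    (hcF : ∀ i, c i ∈ fieldOf (Submodule.span ℚ ({τ} : Set ℂ) ⊔ Submodule.span ℚ (range (Fin.append c e))))
    (heF : ∀ j, e j ∈ fieldOf (Submodule.span ℚ ({τ} : Set ℂ) ⊔ Submodule.span ℚ (range (Fin.append c e))))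
    (q : Fin k → ℚ) (hq : q ≠ 0) :
    (∑ j, q j • (j₂ ⟨e j, heF j⟩ - j₁ ⟨e j, heF j⟩)) ∉
      Submodule.span ℚ ({t} : Set K) ⊔ Submodule.span ℚ (range fun i => j₁ ⟨c i, hcF i⟩) :=
  DoubleBase.genPos he' hlin hfree hfix hrel hj₁ hj₂ hv ht hcF heF q hq

end Summit.Schanuel.Schanuel.Theorems.RigidCore
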